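import Summits.CriticalPhenomena.SAWScalingLimit.Theorems.SAWReversalUpgradePathUpgradeRFlank
import HarnessLib

/-!
# `stub_flankL` — the FLANK LEMMA with a free look-ahead window (crux `PathUpgradeR`,
stmt-CriticalPhenomena-18055, line `bidir_windows`)

This is the one-parameter generalisation of `stub_flank`
(`SAWReversalUpgradePathUpgradeRFlank`): the gate point of hypothesis (Ma) is now looked for in
the long capacity window `[t₁ + 2θ, t₁ + Lθ]` (`2 ≤ L`) instead of `[t₁ + 2θ, t₁ + 4θ]`, and the
time budget `5θ + w ≤ 1` becomes `(L + 1)θ + w ≤ 1`.  (The short window is jointly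
unsatisfiable with the gate constants for capacity-parametrised references, which reach only
`≈ √(Lθ)` in a window of length `Lθ`.)

**Proof.** Word for word the proof of `stub_flank`, with the tube of `3ε`-balls now taken about
`r [M + θ/2, M + (L + 1)θ]` (it contains the gate point `r u`, `u ∈ [t₁ + 2θ, t₁ + Lθ]`, since
`t₁ ≤ M < t₁ + w`, `w < θ/2`) and every time bound `M + 5θ ≤ T + 1` replaced by
`M + (L + 1)θ ≤ T + 1`.  The record/overshoot step of the landed file is bundled in
`PathUpgradeRFlank.exists_record_overshoot` under the budget `5θ + w ≤ 1`, which does *not* follow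
from `(L + 1)θ + w ≤ 1`, `2 ≤ L`; we therefore re-derive it here as two finer lemmas — the
*record* (`exists_record_witness_level`, no `θ` at all) and the *overshoot* above a given record
level (`exists_overshoot_witness`, under the exact room hypothesis `M + θ + 2w ≤ T + 1`) — reusing
the shadowing/witness helpers of `PathUpgradeRFlank`. [folklore]
-/

noncomputable section

open Set Filter Metric Topology Bornology
open scoped NNReal
open UpperHalfPlane (upperHalfPlaneSet isOpen_upperHalfPlaneSet)

namespace Summit.CriticalPhenomena.SAWScalingLimit.Theorems

open Literature.Probability.RandomPlanarGeometry Literature.Probability.RandomPlanarGeometry.Loewner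

namespace PathUpgradeRFlankL

open PathUpgradeRFlank

/-- **Record.** For a `c₀`-sub-front point `X t` (witness `ut` lying `c₀ ≥ w` below the witness
level of an earlier point), the maximal witness level `M` over `X[0, t]` is attained at a time
`t₁ < t` with `t₁ ≤ M < t₁ + w` and `ut + c₀ ≤ M`; no capacity-window constant enters.
[folklore] -/
theorem exists_record_witness_level {X r : ℝ≥0 → ℂ} (hX : Continuous X) (hr : Continuous r)
    {T : ℝ≥0} {ε μ w c₀ : ℝ} (hε : 0 ≤ ε) (hεμ : 4 * ε < μ) (hwc : w ≤ c₀)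
    (hsh : ∀ t' : ℝ≥0, (t' : ℝ) ≤ T + 1 → hausdorffDist (X '' Icc 0 t') (r '' Icc 0 t') ≤ ε)
    (hinj : ∀ s t : ℝ≥0, (s : ℝ) ≤ T + 1 → (t : ℝ) ≤ T + 1 → w ≤ |(s : ℝ) - t| →
      μ ≤ dist (r s) (r t))
    {t ut : ℝ≥0} (ht : (t : ℝ) ≤ T) (hut : (ut : ℝ) ≤ T + 1) (hXt : dist (X t) (r ut) ≤ 2 * ε)
    (hsub : ∃ s : ℝ≥0, s ≤ t ∧ ∃ us : ℝ≥0, (us : ℝ) ≤ T + 1 ∧ dist (X s) (r us) ≤ 2 * ε ∧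
      (ut : ℝ) + c₀ ≤ us) :
    ∃ t₁ M : ℝ≥0, t₁ < t ∧ (t₁ : ℝ) ≤ M ∧ (M : ℝ) < t₁ + w ∧ (ut : ℝ) + c₀ ≤ M ∧
      ∀ s u : ℝ≥0, s ≤ t → (u : ℝ) ≤ T + 1 → dist (X s) (r u) ≤ 2 * ε → u ≤ M := by
  obtain ⟨s₀, hs₀, us, hus, hdus, hc₀us⟩ := hsub
  set K : Set (ℝ≥0 × ℝ≥0) :=
    {p | p.1 ≤ t ∧ (p.2 : ℝ) ≤ T + 1 ∧ dist (X p.1) (r p.2) ≤ 2 * ε} with hK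
  have hKc : IsCompact K := by
    refine ((isCompact_Icc (a := (0 : ℝ≥0)) (b := t)).prod
      (isCompact_Icc (a := (0 : ℝ≥0)) (b := T + 1))).of_isClosed_subset ?_ ?_
    · exact (isClosed_le continuous_fst continuous_const).inter
        ((isClosed_le (continuous_subtype_val.comp continuous_snd) continuous_const).inter
        (isClosed_le ((hX.comp continuous_fst).dist (hr.comp continuous_snd)) continuous_const))
    · rintro ⟨a, b⟩ ⟨ha, hb, -⟩
      exact ⟨⟨zero_le, ha⟩, zero_le, by exact_mod_cast hb⟩
  obtain ⟨⟨t₁, M⟩, ⟨ht₁t, hMT, hdM⟩, hmax⟩ :=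
    hKc.exists_isMaxOn ⟨(s₀, us), hs₀, hus, hdus⟩ continuous_snd.continuousOn
  have hrec : ∀ s u : ℝ≥0, s ≤ t → (u : ℝ) ≤ T + 1 → dist (X s) (r u) ≤ 2 * ε → u ≤ M :=
    fun s u hs hu hd ↦ isMaxOn_iff.1 hmax (s, u) ⟨hs, hu, hd⟩
  have hMc₀ : (ut : ℝ) + c₀ ≤ M := hc₀us.trans (NNReal.coe_le_coe.2 (hrec s₀ us hs₀ hus hdus))
  have ht₁t' : (t₁ : ℝ) ≤ t := NNReal.coe_le_coe.2 ht₁t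
  have ht₁T : (t₁ : ℝ) ≤ T + 1 := by linarith
  have ht₁M : (t₁ : ℝ) ≤ M := by
    obtain ⟨s', hs', hd⟩ := exists_bwd_witness hX hr (hsh t₁ ht₁T) le_rfl
    exact NNReal.coe_le_coe.2 (hrec s' t₁ (hs'.trans ht₁t) ht₁T (hd.trans (by linarith)))
  have hMt₁ : (M : ℝ) < t₁ + w := by
    obtain ⟨u', hu', hd⟩ := exists_fwd_witness hX hr (hsh t₁ ht₁T) le_rfl
    have hu't₁ : (u' : ℝ) ≤ t₁ := NNReal.coe_le_coe.2 hu'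
    have h := abs_sub_lt_iff.1 (abs_sub_lt_of_witness hinj (hu't₁.trans ht₁T) hMT hd hdM
      (dist_self (X t₁)).le (by linarith : ε + 2 * ε + 0 < μ))
    linarith [h.1, h.2]
  refine ⟨t₁, M, lt_of_le_of_ne ht₁t fun heq ↦ ?_, ht₁M, hMt₁, hMc₀, hrec⟩
  rw [heq] at hdM
  have h := abs_sub_lt_iff.1 (abs_sub_lt_of_witness hinj hMT hut hdM hXt (dist_self (X t)).le
    (by linarith : 2 * ε + 2 * ε + 0 < μ))
  linarith [h.1, h.2]

/-- **Overshoot.** If `M` bounds the witness levels over `X[0, t]` and there is room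
`M + θ + 2w ≤ T + 1`, then the first time `t₂ ≥ t` carrying a witness `u₂` at level `≥ M + θ`
satisfies `t₂ ≤ M + θ + 2w` and `u₂ < t₂ + w`. [folklore] -/
theorem exists_overshoot_witness {X r : ℝ≥0 → ℂ} (hX : Continuous X) (hr : Continuous r)
    {T : ℝ≥0} {ε μ w θ : ℝ} (hε : 0 ≤ ε) (hεμ : 3 * ε < μ) (hw : 0 < w) (hθ : 0 ≤ θ)
    (hsh : ∀ t' : ℝ≥0, (t' : ℝ) ≤ T + 1 → hausdorffDist (X '' Icc 0 t') (r '' Icc 0 t') ≤ ε)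
    (hinj : ∀ s t : ℝ≥0, (s : ℝ) ≤ T + 1 → (t : ℝ) ≤ T + 1 → w ≤ |(s : ℝ) - t| →
      μ ≤ dist (r s) (r t))
    {t M : ℝ≥0} (hMT : (M : ℝ) + θ + 2 * w ≤ T + 1)
    (hrec : ∀ s u : ℝ≥0, s ≤ t → (u : ℝ) ≤ T + 1 → dist (X s) (r u) ≤ 2 * ε → u ≤ M) :
    ∃ t₂ u₂ : ℝ≥0, t ≤ t₂ ∧ (t₂ : ℝ) ≤ M + θ + 2 * w ∧ (M : ℝ) + θ ≤ u₂ ∧ (u₂ : ℝ) < t₂ + w ∧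
      (u₂ : ℝ) ≤ T + 1 ∧ dist (X t₂) (r u₂) ≤ 2 * ε := by
  have hu₀nn : 0 ≤ (M : ℝ) + θ + 2 * w := by positivity
  set u₀ : ℝ≥0 := ⟨(M : ℝ) + θ + 2 * w, hu₀nn⟩ with hu₀def
  have hu₀ : (u₀ : ℝ) = M + θ + 2 * w := rfl
  have hu₀T : (u₀ : ℝ) ≤ T + 1 := hu₀ ▸ hMT
  obtain ⟨s'', hs''u₀, hd''⟩ := exists_bwd_witness hX hr (hsh u₀ hu₀T) le_rfl
  have hs''u₀' : (s'' : ℝ) ≤ M + θ + 2 * w := hu₀ ▸ NNReal.coe_le_coe.2 hs''u₀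
  have hts'' : t ≤ s'' := by
    by_contra h
    have h' := NNReal.coe_le_coe.2 (hrec s'' u₀ (not_le.1 h).le hu₀T (hd''.trans (by linarith)))
    rw [hu₀] at h'
    linarith
  set K₂ : Set (ℝ≥0 × ℝ≥0) := {p | t ≤ p.1 ∧ (p.1 : ℝ) ≤ T + 1 ∧ (M : ℝ) + θ ≤ p.2 ∧
    (p.2 : ℝ) ≤ T + 1 ∧ dist (X p.1) (r p.2) ≤ 2 * ε} with hK₂
  have hK₂c : IsCompact K₂ := by
    refine ((isCompact_Icc (a := (0 : ℝ≥0)) (b := T + 1)).prod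
      (isCompact_Icc (a := (0 : ℝ≥0)) (b := T + 1))).of_isClosed_subset ?_ ?_
    · exact (isClosed_le continuous_const continuous_fst).inter
        ((isClosed_le (continuous_subtype_val.comp continuous_fst) continuous_const).inter
        ((isClosed_le continuous_const (continuous_subtype_val.comp continuous_snd)).inter
        ((isClosed_le (continuous_subtype_val.comp continuous_snd) continuous_const).inter
        (isClosed_le ((hX.comp continuous_fst).dist (hr.comp continuous_snd))
          continuous_const))))
    · rintro ⟨a, b⟩ ⟨-, ha, -, hb, -⟩
      exact ⟨⟨zero_le, by exact_mod_cast ha⟩, zero_le, by exact_mod_cast hb⟩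
  have hmem : (s'', u₀) ∈ K₂ :=
    ⟨hts'', hs''u₀'.trans hMT, by rw [hu₀]; linarith, hu₀T, hd''.trans (by linarith)⟩
  obtain ⟨⟨t₂, u₂⟩, ⟨htt₂, ht₂T, hMu₂, hu₂T, hd₂⟩, hmin⟩ :=
    hK₂c.exists_isMinOn ⟨_, hmem⟩ continuous_fst.continuousOn
  have ht₂u₀ : (t₂ : ℝ) ≤ M + θ + 2 * w :=
    (NNReal.coe_le_coe.2 (isMinOn_iff.1 hmin (s'', u₀) hmem)).trans hs''u₀'
  have hu₂t₂ : (u₂ : ℝ) < t₂ + w := by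
    obtain ⟨u'', hu'', hd⟩ := exists_fwd_witness hX hr (hsh t₂ ht₂T) le_rfl
    have hu''t₂ : (u'' : ℝ) ≤ t₂ := NNReal.coe_le_coe.2 hu''
    have h := abs_sub_lt_iff.1 (abs_sub_lt_of_witness hinj (hu''t₂.trans ht₂T) hu₂T hd hd₂
      (dist_self (X t₂)).le (by linarith : ε + 2 * ε + 0 < μ))
    linarith [h.1, h.2]
  exact ⟨t₂, u₂, htt₂, ht₂u₀, hMu₂, hu₂t₂, hu₂T, hd₂⟩

end PathUpgradeRFlankL

open PathUpgradeRFlank PathUpgradeRFlankL in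
/-- **The Flank Lemma with a free look-ahead window** (deterministic heart of the ORDER half of
crux `PathUpgradeR`): a `c₀`-sub-front point `ψ̄ (ζ t)` of a Loewner chain with simple trace,
`ε`-shadowed by a regular reference curve, with small driver oscillation on short capacity
windows, a conformally far gate point in the window `[t₁ + 2θ, t₁ + Lθ]` and a gate decomposition
at its record time, is flanked by its past along every short segment towards a conformally far
point `e`: `∃ s < t, ψ̄ (ζ s) ∈ segment ℝ (ψ̄ (ζ t)) e`. [folklore] -/
theorem stub_flankL : ∀ (E : Literature.Probability.RandomPlanarGeometry.DobrushinDomain) (ψ : Literature.Probability.RandomPlanarGeometry.ConformalEquiv UpperHalfPlane.upperHalfPlaneSet E.carrier), E.IsChordalUniformizing ψ → ∀ (U : NNReal → ℝ) (ζ ρ : NNReal → ℂ), Continuous U → Literature.Probability.RandomPlanarGeometry.Loewner.IsGeneratedByCurve U ζ → Literature.Probability.RandomPlanarGeometry.Loewner.IsSimpleTrace ζ → Continuous ρ → (∀ u, 0 ≤ (ρ u).im) → ∀ (T : NNReal) (ε μ μ₀ w θ c₀ ρ₁ m₁ h₀ d' dS lam r₁ Rout α₀ dB L : ℝ), 0 <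 ε → 5 * ε < μ → 0 < w → w < θ / 2 → 8 * θ < c₀ → 2 ≤ L → (L + 1) * θ + w ≤ 1 → 0 ≤ ρ₁ → 0 < r₁ → 5 * (ρ₁ + Real.sqrt (θ + 4 * w)) ≤ r₁ → 0 < Rout → Rout ≤ m₁ → Rout ≤ h₀ → 0 ≤ dS → lam + 5 * ε + 2 * dS < μ₀ → 3 * ε < dB → 2 * dS + 2 * ε < dB → 0 < α₀ → (∀ t : NNReal, (t : ℝ) ≤ T + 1 → Metric.hausdorffDist (ψ.boundaryExtension '' (ζ '' Set.Icc 0 t)) ((fun u => ψ.boundaryExtension (ρ u)) '' Set.Icc 0 t) ≤ ε) → (∀ s t : NNReal, (s : ℝ) ≤ T + 1 → (t : ℝ) ≤ T + 1 → w ≤ |(s : ℝ) - t| → μ ≤ dist (ψ.boundaryExtension (ρ s)) (ψ.boundaryExtension (ρ t))) → (∀ s t : NNReal, (s : ℝ) ≤ T + 1 → (t : ℝ) ≤ T + 1 → c₀ / 4 ≤ |(s : ℝ) - t| → μ₀ ≤ dist (ψ.boundaryExtension (ρ s)) (ψ.boundaryExtension (ρ t))) → (∀ s s' : NNReal, (s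 : ℝ) ≤ T + 1 → (s' : ℝ) ≤ T + 1 → |(s : ℝ) - s'| ≤ θ + 4 * w → |U s - U s'| ≤ ρ₁) → (∀ t₁ : NNReal, (t₁ : ℝ) ≤ T → ∃ u : NNReal, (t₁ : ℝ) + 2 * θ ≤ u ∧ (u : ℝ) ≤ t₁ + L * θ ∧ ρ u ∈ Literature.Probability.RandomPlanarGeometry.Loewner.domain U t₁ ∧ m₁ ≤ ‖Literature.Probability.RandomPlanarGeometry.Loewner.map U t₁ (ρ u) - U t₁‖) → (∀ t₁ : NNReal, (t₁ : ℝ) ≤ T → ∀ e ∈ E.carrier, d' ≤ Metric.infDist e ((fun u => ψ.boundaryExtension (ρ u)) '' Set.Icc 0 (T + 1) ∪ frontier E.carrier) → ψ.symm e ∈ Literature.Probability.RandomPlanarGeometry.Loewner.domain U t₁ ∧ h₀ ≤ (Literature.Probability.RandomPlanarGeometry.Loewner.map U t₁ (ψ.symm e)).im) → (∀ u : NNReal, α₀ / 2 ≤ (u : ℝ) → (u : ℝ) ≤ T + 1 → dB ≤ Metric.infDist (ψ.boundaryExtension (ρ u)) (frontier E.carrier)) → (∀ t₁ : NNReal, (t₁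 : ℝ) ≤ T → ∃ C P Q : Set ℂ, (∀ p ∈ C, ∀ q ∈ C, dist p q ≤ lam) ∧ Disjoint P Q ∧ Disjoint P C ∧ Disjoint Q C ∧ P ∪ Q ∪ C = ψ '' (Literature.Probability.RandomPlanarGeometry.Loewner.domain U t₁) ∧ (∀ S : Set ℂ, IsPreconnected S → S ⊆ P ∪ Q → S ⊆ P ∨ S ⊆ Q) ∧ (∀ y : ℂ, 0 < y.im → dist y (U t₁) ≤ r₁ → ψ (Literature.Probability.RandomPlanarGeometry.Loewner.loewnerInv U t₁ y) ∈ P) ∧ (∀ y : ℂ, 0 < y.im → Rout ≤ dist y (U t₁) → ψ (Literature.Probability.RandomPlanarGeometry.Loewner.loewnerInv U t₁ y) ∈ Q)) → ∀ t : NNReal, (t : ℝ) ≤ T → ∀ ut : NNReal, α₀ ≤ (ut : ℝ) → (ut : ℝ) ≤ T + 1 → dist (ψ.boundaryExtension (ζ t)) (ψ.boundaryExtension (ρ ut)) ≤ 2 * ε → (∃ s : NNReal, s ≤ t ∧ ∃ us : NNReal, (us : ℝ) ≤ T + 1 ∧ dist (ψ.boundaryExtension (ζ s)) (ψ.boundaryExtension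 (ρ us)) ≤ 2 * ε ∧ (ut : ℝ) + c₀ ≤ us) → ∀ e ∈ E.carrier, dist e (ψ.boundaryExtension (ζ t)) ≤ 2 * dS → d' ≤ Metric.infDist e ((fun u => ψ.boundaryExtension (ρ u)) '' Set.Icc 0 (T + 1) ∪ frontier E.carrier) → ∃ s : NNReal, s < t ∧ ψ.boundaryExtension (ζ s) ∈ segment ℝ (ψ.boundaryExtension (ζ t)) e := by
  intro E ψ _ U ζ ρ hU hgen hsim hρ hρim T ε μ μ₀ w θ c₀ ρ₁ m₁ h₀ d' dS lam r₁ Rout α₀ dB L hε hεμ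
    hw hwθ hθc hL hθ1 hρ₁ _ hr₁ _ hRm₁ hRh₀ hdS hμ₀ hdB3 hdB2 _ hsh hinj hinj₀ hosc hMa hMb hbd
    hgate t ht ut hαut hutT hXt hsub e he hedS hed'
  -- continuity of `X = ψ̄ ∘ ζ` and `r = ψ̄ ∘ ρ`; `r` takes values in `closure E`
  have hcont := continuousOn_boundaryExtension_im_nonneg ψ
  have hXc : Continuous fun s ↦ ψ.boundaryExtension (ζ s) :=
    hcont.comp_continuous hgen.continuous fun s ↦ hgen.im_nonneg s
  have hrc : Continuous fun u ↦ ψ.boundaryExtension (ρ u) := hcont.comp_continuous hρ hρim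
  have hrclos : ∀ u, ψ.boundaryExtension (ρ u) ∈ closure E.carrier := fun u ↦
    JordanDomain.mapsTo_boundaryExtension_holds E.toJordanDomain ψ
      (mem_closure_upperHalfPlaneSet_iff.2 (hρim u))
  have hsh' : ∀ t' : ℝ≥0, (t' : ℝ) ≤ T + 1 →
      hausdorffDist ((fun s ↦ ψ.boundaryExtension (ζ s)) '' Icc 0 t')
        ((fun u ↦ ψ.boundaryExtension (ρ u)) '' Icc 0 t') ≤ ε := fun t' ht' ↦ by
    have h := hsh t' ht'
    rwa [image_image] at h
  have hθ : 0 < θ := by linarith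
  -- the long window: `2θ ≤ Lθ`, `(L + 1)θ = Lθ + θ`
  have hLθ : 2 * θ ≤ L * θ := mul_le_mul_of_nonneg_right hL hθ.le
  have hL1θ : (L + 1) * θ = L * θ + θ := by ring
  -- (1) record time `t₁` and record level `M`
  obtain ⟨t₁, M, ht₁t, ht₁M, hMt₁, hMc₀, hrec⟩ := exists_record_witness_level hXc hrc hε.le
    (by linarith) (by linarith) hsh' hinj ht hutT hXt hsub
  have ht₁t' : (t₁ : ℝ) < t := NNReal.coe_lt_coe.2 ht₁t
  have ht₁T : (t₁ : ℝ) ≤ T := by linarith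
  have ht₁T1 : (t₁ : ℝ) ≤ T + 1 := by linarith
  have hMtop : (M : ℝ) + (L + 1) * θ ≤ T + 1 := by linarith
  -- (2) overshoot time `t₂` with witness `u₂`
  obtain ⟨t₂, u₂, htt₂, ht₂M, hMu₂, hu₂t₂, hu₂T, hd₂⟩ := exists_overshoot_witness hXc hrc hε.le
    (by linarith) hw hθ.le hsh' hinj (t := t) (M := M) (by linarith) hrec
  have htt₂' : (t : ℝ) ≤ t₂ := NNReal.coe_le_coe.2 htt₂
  -- (3) the gate at `t₁` and the pocket `X (t₁, t₂] ⊆ P`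
  obtain ⟨C, P, Q, hClam, hPQ, -, -, hPQC, hsides, hP, hQ⟩ := hgate t₁ ht₁T
  have hpocket : ∀ s : ℝ≥0, t₁ < s → s ≤ t₂ → ψ.boundaryExtension (ζ s) ∈ P := by
    intro s h1 h2
    have hosc' : ∀ v : ℝ≥0, t₁ ≤ v → v ≤ t₂ → |U v - U t₁| ≤ ρ₁ := fun v hv1 hv2 ↦ by
      have hv1' : (t₁ : ℝ) ≤ v := NNReal.coe_le_coe.2 hv1
      have hv2' : (v : ℝ) ≤ t₂ := NNReal.coe_le_coe.2 hv2
      refine hosc v t₁ (by linarith) ht₁T1 ?_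
      rw [abs_of_nonneg (by linarith)]
      linarith
    obtain ⟨hdom, hdist⟩ := dist_map_le_of_osc hU hgen hsim h1 h2 hosc'
    have hnear : dist (map U t₁ (ζ s)) (U t₁) ≤ r₁ := by
      refine hdist.trans (le_trans ?_ hr₁)
      have hsq : Real.sqrt ((t₂ : ℝ) - t₁) ≤ Real.sqrt (θ + 4 * w) :=
        Real.sqrt_le_sqrt (by linarith)
      linarith [Real.sqrt_nonneg (θ + 4 * w)]
    have h := hP _ (im_map_pos hU hdom) hnear
    rwa [apply_loewnerInv_map ψ hU hdom] at h
  -- (4) the tube `G` about `r [M + θ/2, M + (L + 1)θ]`: misses the past, meets `P` and `Q`,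
  -- hence `C`
  set G : Set ℂ := thickening (3 * ε) ((fun u ↦ ψ.boundaryExtension (ρ u)) ''
    {u : ℝ≥0 | (M : ℝ) + θ / 2 ≤ (u : ℝ) ∧ (u : ℝ) ≤ M + (L + 1) * θ}) with hG
  have hGpast : ∀ s : ℝ≥0, s ≤ t₁ → ψ.boundaryExtension (ζ s) ∉ G := fun s hs hsG ↦ by
    obtain ⟨u, hu1, hu2, hd⟩ := mem_tube_iff.1 hsG
    obtain ⟨u', hu', hd'⟩ := exists_fwd_witness hXc hrc (hsh' t₁ ht₁T1) hs
    have hu't₁ : (u' : ℝ) ≤ t₁ := NNReal.coe_le_coe.2 hu'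
    have h := abs_sub_lt_iff.1 (abs_sub_lt_of_witness hinj (by linarith) (by linarith) hd.le hd'
      (dist_self _).le (by linarith : 3 * ε + ε + 0 < μ))
    linarith [h.1, h.2]
  have hX₂G : ψ.boundaryExtension (ζ t₂) ∈ G :=
    mem_tube_iff.2 ⟨u₂, by linarith, by linarith, hd₂.trans_lt (by linarith)⟩
  obtain ⟨uq, huq1, huq2, hρdom, hm₁⟩ := hMa t₁ ht₁T
  have hqG : ψ.boundaryExtension (ρ uq) ∈ G :=
    mem_tube_iff.2 ⟨uq, by linarith, by linarith, by rw [dist_self]; linarith⟩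
  have hqQ : ψ.boundaryExtension (ρ uq) ∈ Q := by
    have h := hQ _ (im_map_pos hU hρdom) (by rw [dist_eq_norm]; exact hRm₁.trans hm₁)
    rwa [apply_loewnerInv_map ψ hU hρdom] at h
  have hGsub : G ⊆ P ∪ Q ∪ C := fun x hx ↦ by
    obtain ⟨u, hu1, hu2, hd⟩ := mem_tube_iff.1 hx
    have hxE : x ∈ E.carrier :=
      ball_subset_of_le_infDist_frontier E.isOpen (hrclos u) (by linarith)
        (hbd u (by linarith) (by linarith)) (mem_ball.2 (hd.trans (by linarith)))
    rw [hPQC]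
    by_contra hx'
    obtain ⟨s, -, hst₁, rfl⟩ := exists_eq_of_not_mem_image_domain ψ hgen hsim hxE hx'
    exact hGpast s hst₁ hx
  obtain ⟨cstar, hcC, hcG⟩ := exists_mem_inter_of_meets hsides hPQ
    (isPreconnected_tube hrc (by linarith)) hGsub hX₂G (hpocket t₂ (ht₁t.trans_le htt₂) le_rfl)
    hqG hqQ
  obtain ⟨uc, huc1, huc2, hdc⟩ := mem_tube_iff.1 hcG
  -- (5) the transversal segment `S` from `X t ∈ P` to `e ∈ Q`: in `E`, misses `C`
  set S : Set ℂ := segment ℝ (ψ.boundaryExtension (ζ t)) e with hS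
  have hSball : S ⊆ closedBall (ψ.boundaryExtension (ρ ut)) (2 * dS + 2 * ε) := by
    refine (convex_closedBall _ _).segment_subset ?_ ?_
    · rw [mem_closedBall]
      linarith
    · rw [mem_closedBall]
      linarith [dist_triangle e (ψ.boundaryExtension (ζ t)) (ψ.boundaryExtension (ρ ut))]
  have hSE : S ⊆ E.carrier := fun x hx ↦
    ball_subset_of_le_infDist_frontier E.isOpen (hrclos ut) (by linarith)
      (hbd ut (by linarith) hutT) (mem_ball.2 ((mem_closedBall.1 (hSball hx)).trans_lt hdB2))
  have hSC : ∀ x ∈ S, x ∉ C := fun x hx hxC ↦ by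
    have h1 : dist x cstar ≤ lam := hClam x hxC cstar hcC
    have h2 := mem_closedBall.1 (hSball hx)
    have h3 : μ₀ ≤ dist (ψ.boundaryExtension (ρ uc)) (ψ.boundaryExtension (ρ ut)) :=
      hinj₀ uc ut (by linarith) hutT (by rw [abs_of_nonneg (by linarith)]; linarith)
    linarith [dist_triangle4 (ψ.boundaryExtension (ρ uc)) cstar x (ψ.boundaryExtension (ρ ut)),
      dist_comm cstar (ψ.boundaryExtension (ρ uc)), dist_comm x cstar]
  have heQ : e ∈ Q := by
    obtain ⟨hzdom, hh₀⟩ := hMb t₁ ht₁T e he hed'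
    have hfar : Rout ≤ dist (map U t₁ (ψ.symm e)) (U t₁) := by
      refine (hRh₀.trans hh₀).trans ?_
      rw [dist_eq_norm]
      simpa using Complex.im_le_norm (map U t₁ (ψ.symm e) - U t₁)
    have h := hQ _ (im_map_pos hU hzdom) hfar
    rwa [loewnerInv_map hU hzdom, ψ.apply_symm_apply he] at h
  have hnot : ¬ S ⊆ P ∪ Q ∪ C := fun hsub' ↦ by
    obtain ⟨c, hcC', hcS⟩ := exists_mem_inter_of_meets hsides hPQ
      (convex_segment _ _).isPreconnected hsub' (left_mem_segment ℝ _ _)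
      (hpocket t ht₁t htt₂) (right_mem_segment ℝ _ _) heQ
    exact hSC c hcS hcC'
  obtain ⟨p, hpS, hp⟩ := not_subset.1 hnot
  rw [hPQC] at hp
  obtain ⟨s, -, hst₁, hps⟩ := exists_eq_of_not_mem_image_domain ψ hgen hsim (hSE hpS) hp
  exact ⟨s, lt_of_le_of_lt hst₁ ht₁t, hps ▸ hpS⟩

end Summit.CriticalPhenomena.SAWScalingLimit.Theorems
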